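import Literature.MathematicalPhysics.QuantumLattice.HeatKernelGroup
import HarnessLib

/-!
# Time rescaling of group heat kernels (discharge of `IsGroupHeatKernel.comp_mul`)

Discharge of the named fact
`Literature.MathematicalPhysics.QuantumLattice.IsGroupHeatKernel.comp_mul` stated in
`Literature/MathematicalPhysics/QuantumLattice/HeatKernelGroup.lean`:

* `IsGroupHeatKernel.comp_mul_holds : comp_mul` — if `p` is a heat kernel of the compact group
  `G` (hypothesis structure `IsGroupHeatKernel p`: jointly continuous, non-negative, normalised,
  central, symmetric convolution semigroup w.r.t. normalised Haar measure, approximate identity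
  as `t → 0⁺`, no jumps) and `c > 0`, then the time-rescaled kernel `(t, g) ↦ p_{ct}(g)` is again
  a heat kernel.

Printed context (Lévy 2010, Ch. 4 §2, "The Lévy process associated to a Markovian holonomy
field"): a conjugation-invariant Lévy process `X` on a compact Lie group `G` has generator given
by Hunt's formula (loc. cit., Prop. 2.2)
`L f = ½ ∑ a_{jk} A_j A_k f + A₀ f + ∫ [f(gh) - f(g) - (A(h)f)(g)] Π(dh)` with a conjugation
invariant diffusive part `L_D = ½ ∑ a_{jk} A_j A_k`; the Brownian case (`A₀ = 0`, `Π = 0`) gives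
the heat kernels, and on a simple group `L_D` is "a non-negative multiple of the Laplace
operator" (loc. cit., discussion after Def. 2.6).  The time-changed process `(X_{ct})_t` is again
a conjugation-invariant Lévy process issued from `1`, with generator `cL`, i.e. diffusive part
`½ ∑ (c a_{jk}) A_j A_k` and still no drift and no jumps: `p_{c·}` is the heat kernel of `cΔ`.

Lean proof (elementary, axiom by axiom): the pointwise axioms (`nonneg`, `integral_eq_one`,
`central`, `symm`) and the joint continuity on `(0, ∞) × G` are those of `p` at time `ct > 0`
(continuity: compose with the continuous self-map `(t, g) ↦ (ct, g)` of `(0, ∞) × G`);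
Chapman–Kolmogorov for the rescaled kernel is that of `p` at times `cs`, `ct` because
`c (s + t) = cs + ct`; the two `t → 0⁺` axioms (`tendsto_dirac`, `noJumps`) are those of `p`
composed with the time change `t ↦ ct`, which maps the filter `𝓝[>] 0` into itself, together
with `t⁻¹ = c · (ct)⁻¹` for `noJumps`.

## References

* [Levy2010] T. Lévy, *Two-dimensional Markovian holonomy fields*, Astérisque **329** (2010),
  arXiv:0804.2230; Ch. 4 §2 (Prop. 2.2: Hunt's formula for conjugation-invariant Lévy processes;
  Def. 2.6: admissible Lévy processes).
* G. A. Hunt, *Semi-groups of measures on Lie groups*, Trans. AMS **81** (1956) 264–293, Thm 5.1.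
-/

open MeasureTheory Filter Topology

noncomputable section

namespace Literature.MathematicalPhysics.QuantumLattice

variable {G : Type*} [Group G] [TopologicalSpace G] [IsTopologicalGroup G] [CompactSpace G]
  [MeasurableSpace G] [BorelSpace G]

namespace IsGroupHeatKernel

variable {p : ℝ → G → ℝ}

/-- **Discharge of `IsGroupHeatKernel.comp_mul` (time rescaling).**  For `c > 0` the rescaled
kernel `q_t := p_{ct}` satisfies every axiom of `IsGroupHeatKernel`: the pointwise axioms
(`nonneg`, `integral_eq_one`, `central`, `symm`) and the joint continuity on `(0, ∞) × G` are read
off from those of `p` at time `ct > 0` (composing with the self-map `(t, g) ↦ (ct, g)` of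
`(0, ∞) × G`); Chapman–Kolmogorov for `q` is that of `p` at times `cs, ct` since
`c (s + t) = cs + ct`; and the two `t → 0⁺` statements (`tendsto_dirac`, `noJumps`) are those of
`p` composed with the time change `t ↦ ct`, which maps the filter `𝓝[>] 0` into itself, using
`t⁻¹ = c · (ct)⁻¹` for `noJumps`.  In the language of Lévy (2010), Ch. 4 §2: if `(X_t)` is a
conjugation-invariant Lévy process on `G` issued from `1` with generator `L` given by Hunt's
formula (loc. cit., Prop. 2.2: diffusive part `½ ∑ a_{jk} A_j A_k`, drift `A₀ ∈ 𝔷`, Lévy measure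
`Π`), then `(X_{ct})` is again such a process, with generator `cL` (diffusive part
`½ ∑ (c a_{jk}) A_j A_k`, no drift and no jumps if `X` has none) — i.e. `p_{c·}` is the heat kernel
of `cΔ`. [cite: Levy2010, §4.2] -/
theorem comp_mul_holds : comp_mul (p := p) := by
  intro hp c hc
  have hct : ∀ {t : ℝ}, 0 < t → 0 < c * t := fun ht => mul_pos hc ht
  -- the time change `t ↦ c t` maps `𝓝[>] 0` into itself
  have hmul : Tendsto (fun t : ℝ => c * t) (𝓝[>] (0 : ℝ)) (𝓝[>] (0 : ℝ)) := by
    refine tendsto_nhdsWithin_iff.mpr ⟨?_, ?_⟩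
    · have h : Tendsto (fun t : ℝ => c * t) (𝓝 0) (𝓝 (c * 0)) :=
        (continuous_const.mul continuous_id).tendsto 0
      rw [mul_zero] at h
      exact h.mono_left nhdsWithin_le_nhds
    · filter_upwards [self_mem_nhdsWithin] with t ht
      exact hct ht
  refine ⟨?_, ?_, ?_, ?_, ?_, ?_, ?_, ?_⟩
  · -- joint continuity: compose with the self-map `(t, g) ↦ (c t, g)` of `(0, ∞) × G`
    have hcont : Continuous (fun x : ℝ × G => (c * x.1, x.2)) := by fun_prop
    have hmaps : Set.MapsTo (fun x : ℝ × G => (c * x.1, x.2))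
        (Set.Ioi (0 : ℝ) ×ˢ Set.univ) (Set.Ioi (0 : ℝ) ×ˢ Set.univ) :=
      fun x hx => ⟨hct hx.1, Set.mem_univ _⟩
    exact hp.continuousOn.comp hcont.continuousOn hmaps
  · exact fun t ht g => hp.nonneg (c * t) (hct ht) g
  · exact fun t ht => hp.integral_eq_one (c * t) (hct ht)
  · intro s t hs ht g
    simp only [mul_add]
    exact hp.semigroup (c * s) (c * t) (hct hs) (hct ht) g
  · exact fun t ht g h => hp.central (c * t) (hct ht) g h
  · exact fun t ht g => hp.symm (c * t) (hct ht) g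
  · exact fun f => (hp.tendsto_dirac f).comp hmul
  · intro U hU
    have h := ((hp.noJumps U hU).comp hmul).const_mul c
    rw [mul_zero] at h
    refine h.congr fun t => ?_
    simp only [Function.comp_def]
    rw [mul_inv, mul_assoc, mul_inv_cancel_left₀ hc.ne']

/-- Corollary form with the hypotheses explicit (dot notation on `IsGroupHeatKernel`):
`IsGroupHeatKernel p → 0 < c → IsGroupHeatKernel (fun t g => p (c * t) g)` (Lévy 2010, Ch. 4 §2,
time change of a conjugation-invariant Lévy process). [cite: Levy2010, §4.2] -/
theorem comp_mul' (hp : IsGroupHeatKernel p) {c : ℝ} (hc : 0 < c) :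
    IsGroupHeatKernel (fun t g => p (c * t) g) :=
  comp_mul_holds hp hc

/-! ### The sup bound on the Driver–Sengupta loop value (discharge of `abs_ym2LoopValue_le`)

Discharge of the named fact
`Literature.MathematicalPhysics.QuantumLattice.IsGroupHeatKernel.abs_ym2LoopValue_le` of
`HeatKernelGroup.lean`: for a heat kernel `p` of the compact group `G`, a function `χ : G → ℝ` with
`|χ| ≤ C` and an area `A > 0`, the `YM₂` loop value `W(A) = ym2LoopValue χ p A = ∫ χ(g) p_A(g) dg`
satisfies `|W(A)| ≤ C`.

Source: B. K. Driver, *YM₂: continuum expectations, lattice convergence, and lassos*, Comm. Math.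
Phys. **123** (1989) 575–616, doi:10.1007/BF01218586, §6 (loop expectations `∫_G χ p_A` of simple
loops, bounded by `sup |χ|` because `p_A dg` is a probability measure).  The paper is not held in
the local store; the statement discharged is the vendored one, unchanged, and the proof is the
one-line estimate using only the fields `nonneg` and `integral_eq_one` of `IsGroupHeatKernel`:
`p_A` is continuous on the compact group, hence Haar-integrable (`IsGroupHeatKernel.integrable`),
so `C · p_A` is integrable and dominates the integrand in norm, `|χ(g) p_A(g)| = |χ(g)| p_A(g) ≤
C p_A(g)`; Mathlib's `norm_integral_le_of_norm_le` (which needs no measurability of the integrand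
`χ · p_A` — a non-integrable integrand has Bochner integral `0`) gives
`|∫ χ p_A| ≤ ∫ C p_A = C ∫ p_A = C` (`integral_const_mul`, `integral_eq_one`). -/

open Literature.MathematicalPhysics.QuantumFieldTheory (haarProbability) in
/-- **Discharge** of `abs_ym2LoopValue_le` (Driver 1989 §6): `|W(A)| = |∫ χ p_A| ≤ ∫ |χ| p_A ≤
C ∫ p_A = C`, using only that `p_A` is a Haar-integrable probability density (`integrable`,
`nonneg`, `integral_eq_one`).  No measurability of `χ` is needed: `norm_integral_le_of_norm_le`
bounds the Bochner integral of an arbitrary integrand dominated in norm by the integrable function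
`C · p_A`. [cite: Driver1989, §6] -/
theorem abs_ym2LoopValue_le_holds : abs_ym2LoopValue_le (p := p) := by
  intro hp χ C hχ A hA
  have key : ‖∫ g, χ g * p A g ∂(haarProbability G)‖ ≤ ∫ g, C * p A g ∂(haarProbability G) := by
    refine norm_integral_le_of_norm_le ((hp.integrable hA).const_mul C)
      (Eventually.of_forall fun g => ?_)
    rw [Real.norm_eq_abs, abs_mul, abs_of_nonneg (hp.nonneg A hA g)]
    exact mul_le_mul_of_nonneg_right (hχ g) (hp.nonneg A hA g)
  rw [integral_const_mul, hp.integral_eq_one A hA, mul_one] at key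
  simpa only [ym2LoopValue, Real.norm_eq_abs] using key

end IsGroupHeatKernel

end Literature.MathematicalPhysics.QuantumLattice
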